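import Mathlib
import HarnessLib
import Summits.HubbardSuperconductivity.HubbardSuperconductivity.Theorems.KLProgrammeKLRegimeEngineV8E5Share
import Summits.HubbardSuperconductivity.HubbardSuperconductivity.Theorems.KLProgrammeKLRegimeWickDressedDefect

/-!
# Route `KLProgramme` — ENGINE child gen 8 (stmt-HubbardSuperconductivity-20437 `KLRegimeEngineV17F2`), SKELETON v2 class #3, PROVING side:
# the LINES of the E.5 block as ONE normal covariance each — named symbols `klE5DerivLineSym` (of `Ċ_Λ`) and `klE5SoftLineSym` (of `C∞ − C_Λ`),
# their normal forms, and the support lemmas that discharge the plateau hypotheses of `norm_klE5Block_le_of_tails`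
# (cell gate-hubbard-kl, seat p5 g7; companion of `…EngineV8E5Share` (p541670, the objects) and `…EngineV8E5Block` (p544244, the glue))

WHY.  The bridge (`…EngineV8E5Block` §2/§4) reads the two line families of the block through SYMBOLS: line `0` is `Ċ_Λ = klE5DressedSliceDeriv … κ Λ`,
the soft lines are `C∞ − C_Λ = klE5Total … κ − klE5DressedSlice … κ Λ`; its hypotheses are `normalCovariance (sym s₀) = Ċ_Λ`, `normalCovariance (sym s₁) =
C∞ − C_Λ` (hs₀/hs₁), line data keyed to `sym` (hrow/hcol/hent/hκF/hκG — GAP L1/L2 suppliers), and the plateau conditions `Ċ_Λ X Y ≠ 0 ⇒ R X = R Y = 1`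
(hĊ/hD).  Here the two symbols get NAMES so that the L1/L2 suppliers and the `∃ (C,u)` witness quantify over the same terms:

* `klE5DerivLineSym … n₀ κ Λ ks = ṡ_Λ(ks)/(1 + s_Λ(ks)κ(ks))²` with `klE5DressedSliceDeriv_eq_normalCovariance` (`rfl`);
* `klE5SoftLineSym … n₀ κ Λ ks = m̂(ks)²·(1 − w^K_{Λ_{n₀+1}})·βL²G^K(ks) + s_{Λ_{n₀+1}}/(1+s_{Λ_{n₀+1}}κ) − s_Λ/(1+s_Λκ)`, `m̂ = (1 + s_{Λ_{n₀+1}}κ)⁻¹`, with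
  **`klE5Total_sub_dressedSlice_eq_normalCovariance`** (`klw_softCov_eq_normalCovariance` + `normalCovariance_conj_eq` + symbol additivity);
* `normalCovariance_apply_ne_zero` (a nonzero entry pairs equal momentum–spin labels at a nonzero symbol value), **`normalCovariance_plateau_of_symbol`**
  (symbol supported in `{r = 1}` ⇒ both legs of every nonzero entry in `{r = 1}`), and the two instances `klE5DressedSliceDeriv_plateau`,
  `klE5Total_sub_dressedSlice_plateau` = hypotheses hĊ/hD of `norm_klE5Block_le_of_tails` from symbol supports;
* support reductions `klE5DerivLineSym_ne_zero` (⇒ `∂_Λ w^K_Λ ≠ 0` at the leg's momentum) and `klE5SoftLineSym_eq_zero_of` (the soft symbol vanishes where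
  `w^K_{Λ_{n₀+1}} = 1`, `w^K_Λ = w^K_{Λ_{n₀}}` and `w^K_{Λ_{n₀+1}} = w^K_{Λ_{n₀}}` — i.e. above the step's shell), for the plateau supplier.

Definitions with bodies + exact identities; nothing about the model's sizes is asserted; nothing asserts superconductivity.
-/

noncomputable section

namespace Summit.HubbardSuperconductivity.HubbardSuperconductivity.Theorems.KLRegimeSplit

set_option linter.dupNamespace false -- summit = problem name (single-conjunct summit), D-0017

open Real Finset Literature.MathematicalPhysics.QuantumLattice Literature.Probability.LatticeModels GrassmannAlgebra Matrix
open Literature.MathematicalPhysics.QuantumLattice.FermiRG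
open Summit.HubbardSuperconductivity.HubbardSuperconductivity.Theorems.KLProgrammeLegKernels
open Summit.HubbardSuperconductivity.HubbardSuperconductivity.Theorems.DispersionFlow
open Summit.HubbardSuperconductivity.HubbardSuperconductivity.Theorems.EngineV8
open Summit.HubbardSuperconductivity.HubbardSuperconductivity.Theorems.KLRegimeWick
open Summit.HubbardSuperconductivity.HubbardSuperconductivity.Theorems.TwoPointAssembly

/-! ## §1 Normal covariances: support of the entries -/

section Normal

variable {L M : ℕ}

/-- A nonzero entry of a normal covariance joins two labels with the same momentum–spin part, at a nonzero value of the symbol. [folklore] -/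
theorem normalCovariance_apply_ne_zero (p : FreqMomentum L M × Fin 2 → ℂ) {X Y : HubbardFieldIdx L M} (h : normalCovariance L M p X Y ≠ 0) :
    X.1 = Y.1 ∧ p X.1 ≠ 0 := by
  rw [normalCovariance_apply] at h
  by_cases h1 : X.1 = Y.1
  · refine ⟨h1, fun hp => h ?_⟩
    rw [if_pos h1, hp, neg_zero]
    split_ifs <;> rfl
  · exact absurd (by rw [if_neg h1]) h

/-- **Plateau from the symbol's support**: if `r = 1` wherever the symbol is nonzero, then `r = 1` on both legs of every nonzero entry of the normal
covariance (the shape of hypotheses `hĊ`/`hD` of `norm_klE5Block_le_of_tails`, `r = Σ_ω F_ω`). [folklore] -/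
theorem normalCovariance_plateau_of_symbol (p : FreqMomentum L M × Fin 2 → ℂ) (r : FreqMomentum L M → ℂ)
    (hr : ∀ ks, p ks ≠ 0 → r ks.1 = 1) (X Y : HubbardFieldIdx L M) (h : normalCovariance L M p X Y ≠ 0) : r X.1.1 = 1 ∧ r Y.1.1 = 1 := by
  obtain ⟨hXY, hp⟩ := normalCovariance_apply_ne_zero p h
  exact ⟨hr _ hp, by rw [← hXY]; exact hr _ hp⟩

end Normal

/-! ## §2 The two line symbols of the E.5 block and their normal forms -/

section Lines

variable (L M : ℕ) (β μ : ℝ) (K : TrigPolyC4v) (n₀ : ℕ) (κ : FreqMomentum L M × Fin 2 → ℂ)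

/-- **The line-`0` symbol** `ċ_Λ = ṡ_Λ/(1 + s_Λκ)²` of `Ċ_Λ = klE5DressedSliceDeriv … κ Λ`. -/
def klE5DerivLineSym (Λ : ℝ) (ks : FreqMomentum L M × Fin 2) : ℂ :=
  klE5SliceSymDeriv L M β μ K Λ ks / (1 + klE5SliceSym L M β μ K n₀ Λ ks * κ ks) ^ 2

/-- **The soft-line symbol** of `C∞ − C_Λ = Dm + C_{Λ_{n₀+1}} − C_Λ`:
`m̂²·(1 − w^K_{Λ_{n₀+1}})·βL²G^K + s_{Λ_{n₀+1}}/(1 + s_{Λ_{n₀+1}}κ) − s_Λ/(1 + s_Λκ)`, `m̂ = (1 + s_{Λ_{n₀+1}}κ)⁻¹`. -/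
def klE5SoftLineSym (Λ : ℝ) (ks : FreqMomentum L M × Fin 2) : ℂ :=
  (1 + klE5SliceSym L M β μ K n₀ (klScale klE0 (n₀ + 1)) ks * κ ks)⁻¹ ^ 2 *
      ((1 - (hubbardCutoffWeightCT L M β μ K (klScale klE0 (n₀ + 1)) ks.1 : ℂ)) *
        (((β * (L : ℝ) ^ 2 : ℝ) : ℂ) * ((Complex.I * matsubaraFreq β M ks.1.1 + nambuXiCT L μ K ks.1.2) / nambuDenCT L M β μ 0 K ks.1))) +
    (klE5SliceSym L M β μ K n₀ (klScale klE0 (n₀ + 1)) ks / (1 + klE5SliceSym L M β μ K n₀ (klScale klE0 (n₀ + 1)) ks * κ ks) -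
      klE5SliceSym L M β μ K n₀ Λ ks / (1 + klE5SliceSym L M β μ K n₀ Λ ks * κ ks))

/-- `Ċ_Λ` is the normal covariance of `klE5DerivLineSym`. -/
theorem klE5DressedSliceDeriv_eq_normalCovariance (Λ : ℝ) :
    klE5DressedSliceDeriv L M β μ K n₀ κ Λ = normalCovariance L M (klE5DerivLineSym L M β μ K n₀ κ Λ) := rfl

/-- **Hypothesis `hĊ` of `norm_klE5Block_le_of_tails` from the support of `klE5DerivLineSym`.** -/
theorem klE5DressedSliceDeriv_plateau (Λ : ℝ) (r : FreqMomentum L M → ℂ) (hr : ∀ ks, klE5DerivLineSym L M β μ K n₀ κ Λ ks ≠ 0 → r ks.1 = 1)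
    (X Y : HubbardFieldIdx L M) (h : klE5DressedSliceDeriv L M β μ K n₀ κ Λ X Y ≠ 0) : r X.1.1 = 1 ∧ r Y.1.1 = 1 :=
  normalCovariance_plateau_of_symbol _ r hr X Y h

/-- The line-`0` symbol lives where the cutoff weight MOVES: `klE5DerivLineSym … Λ ks ≠ 0 ⇒ ∂_Λ w^K_Λ(ks) ≠ 0`. -/
theorem deriv_cutoffWeight_ne_zero_of_klE5DerivLineSym_ne_zero (Λ : ℝ) (ks : FreqMomentum L M × Fin 2)
    (h : klE5DerivLineSym L M β μ K n₀ κ Λ ks ≠ 0) : deriv (fun Λ' : ℝ => hubbardCutoffWeightCT L M β μ K Λ' ks.1) Λ ≠ 0 := by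
  intro h0
  refine h ?_
  unfold klE5DerivLineSym klE5SliceSymDeriv
  rw [h0, Complex.ofReal_zero, zero_mul, zero_div]

/-- The partial-slice symbol vanishes where the two cutoff weights agree. -/
theorem klE5SliceSym_eq_zero_of_weight_eq (Λ : ℝ) (ks : FreqMomentum L M × Fin 2)
    (h : hubbardCutoffWeightCT L M β μ K Λ ks.1 = hubbardCutoffWeightCT L M β μ K (klScale klE0 n₀) ks.1) : klE5SliceSym L M β μ K n₀ Λ ks = 0 := by
  unfold klE5SliceSym
  rw [h, sub_self, zero_mul]

/-- **The soft symbol vanishes above the step's shell**: where `w^K_{Λ_{n₀+1}} = 1` (no soft weight) and the partial-slice weights at `Λ` and at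
`Λ_{n₀+1}` both agree with `w^K_{Λ_{n₀}}` (no slice weight), `klE5SoftLineSym … Λ ks = 0` — so its support lies in the union of the soft support
`{w^K_{Λ_{n₀+1}} < 1}` and the slice supports. -/
theorem klE5SoftLineSym_eq_zero_of (Λ : ℝ) (ks : FreqMomentum L M × Fin 2)
    (h1 : hubbardCutoffWeightCT L M β μ K (klScale klE0 (n₀ + 1)) ks.1 = 1)
    (h2 : hubbardCutoffWeightCT L M β μ K (klScale klE0 (n₀ + 1)) ks.1 = hubbardCutoffWeightCT L M β μ K (klScale klE0 n₀) ks.1)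
    (h3 : hubbardCutoffWeightCT L M β μ K Λ ks.1 = hubbardCutoffWeightCT L M β μ K (klScale klE0 n₀) ks.1) :
    klE5SoftLineSym L M β μ K n₀ κ Λ ks = 0 := by
  unfold klE5SoftLineSym
  rw [klE5SliceSym_eq_zero_of_weight_eq L M β μ K n₀ _ ks h2, klE5SliceSym_eq_zero_of_weight_eq L M β μ K n₀ _ ks h3, h1]
  push_cast
  ring

/-- Contrapositive packaging: the soft symbol is supported where one of the three weight conditions fails. -/
theorem klE5SoftLineSym_ne_zero (Λ : ℝ) (ks : FreqMomentum L M × Fin 2) (h : klE5SoftLineSym L M β μ K n₀ κ Λ ks ≠ 0) :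
    hubbardCutoffWeightCT L M β μ K (klScale klE0 (n₀ + 1)) ks.1 ≠ 1 ∨
      hubbardCutoffWeightCT L M β μ K (klScale klE0 (n₀ + 1)) ks.1 ≠ hubbardCutoffWeightCT L M β μ K (klScale klE0 n₀) ks.1 ∨
        hubbardCutoffWeightCT L M β μ K Λ ks.1 ≠ hubbardCutoffWeightCT L M β μ K (klScale klE0 n₀) ks.1 := by
  by_contra hc
  simp only [not_or, ne_eq, not_not] at hc
  exact h (klE5SoftLineSym_eq_zero_of L M β μ K n₀ κ Λ ks hc.1 hc.2.1 hc.2.2)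

variable [NeZero L]

/-- The dressed soft covariance is normal: `Dm = normalCovariance (m̂²·(1 − w^K_{Λ_{n₀+1}})·βL²G^K)`. -/
theorem klE5DressedSoft_eq_normalCovariance :
    klE5DressedSoft L M β μ K n₀ κ = normalCovariance L M (fun ks => (1 + klE5SliceSym L M β μ K n₀ (klScale klE0 (n₀ + 1)) ks * κ ks)⁻¹ ^ 2 *
      ((1 - (hubbardCutoffWeightCT L M β μ K (klScale klE0 (n₀ + 1)) ks.1 : ℂ)) *
        (((β * (L : ℝ) ^ 2 : ℝ) : ℂ) * ((Complex.I * matsubaraFreq β M ks.1.1 + nambuXiCT L μ K ks.1.2) / nambuDenCT L M β μ 0 K ks.1)))) := by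
  unfold klE5DressedSoft
  rw [klw_softCov_eq_normalCovariance]
  exact normalCovariance_conj_eq L M _ _ (fun ks => (1 + klE5SliceSym L M β μ K n₀ (klScale klE0 (n₀ + 1)) ks * κ ks)⁻¹) fun X => rfl

/-- **The soft lines are ONE normal covariance**: `klE5Total … κ − klE5DressedSlice … κ Λ = normalCovariance (klE5SoftLineSym … κ Λ)`. -/
theorem klE5Total_sub_dressedSlice_eq_normalCovariance (Λ : ℝ) :
    klE5Total L M β μ K n₀ κ - klE5DressedSlice L M β μ K n₀ κ Λ = normalCovariance L M (klE5SoftLineSym L M β μ K n₀ κ Λ) := by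
  unfold klE5Total klE5DressedSlice klE5SoftLineSym
  rw [klE5DressedSoft_eq_normalCovariance]
  ext X Y
  simp only [Matrix.sub_apply, Matrix.add_apply, normalCovariance_apply]
  split_ifs <;> ring

/-- **Hypothesis `hD` of `norm_klE5Block_le_of_tails` from the support of `klE5SoftLineSym`.** -/
theorem klE5Total_sub_dressedSlice_plateau (Λ : ℝ) (r : FreqMomentum L M → ℂ) (hr : ∀ ks, klE5SoftLineSym L M β μ K n₀ κ Λ ks ≠ 0 → r ks.1 = 1)
    (X Y : HubbardFieldIdx L M) (h : (klE5Total L M β μ K n₀ κ - klE5DressedSlice L M β μ K n₀ κ Λ) X Y ≠ 0) : r X.1.1 = 1 ∧ r Y.1.1 = 1 := by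
  rw [klE5Total_sub_dressedSlice_eq_normalCovariance] at h
  exact normalCovariance_plateau_of_symbol _ r hr X Y h

end Lines

end Summit.HubbardSuperconductivity.HubbardSuperconductivity.Theorems.KLRegimeSplit

end
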